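/-
Copyright (c) 2026. All rights reserved.
Released under Apache 2.0 license as described in the file LICENSE.
Authors: abc-iut cell, cone prover seat abc-iut-w6-d033 (wave W6, block C; gen 6).
-/
import Literature.AnabelianGeometry.AbsoluteAnabelian.GaloisTheatersNumberFieldShadowTPairs
import Mathlib.Analysis.Complex.Polynomial.Basic
import HarnessLib

/-!
# [AbsTopIII] Def 5.4 (ii): "the restriction morphisms `ρ_v` determine an embedding `M⊚ ↪ ∏_v M_v`" — reduction and an instance

S. Mochizuki, *Topics in absolute anabelian geometry III: global reconstruction algorithms*, J. Math. Sci. Univ. Tokyo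
22 (2015) 939–1156 [MochizukiAbsTopIII2015]; manuscript (`paper:url-5493eb38cbb7`, cell render p0125.txt) p. 125
l. 26–40: "Now suppose that `M⊚ = (V⊚, M⊚, {ρ_v}_{v ∈ V}, {(Π_v ↷ M_v)}_{v ∈ V^non}, {(X_v ↶κ M_v)}_{v ∈ V^arc})` is a
global `T`-pair … Note that the various restriction morphisms `ρ_v` determine a Π-equivariant embedding
`M⊚ ↪ ∏_{v ∈ V} M_v` of `M⊚` into a certain product of local data" — the first step of the CONSTRUCTION of the global
log-Frobenius functor `log⊚_{T,T}` of Def 5.4 (ii).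

PROOF-ONLY companion (no `def`, no `def … : Prop`, no instance / notation; nothing restated or edited) of the typer
abc-iut-L4-t3's FROZEN `TPairs.lean` (`GlobalTPair`, Def 5.1 (v), with its restriction morphisms `ρnon`/`ρarc` and the
reference conditions (a)–(d) `IsTPairReferenceFor`) and of abc-iut-L4-d2's `GaloisTheatersNumberFieldShadowTPairs.lean`
(the `TM`-pair vocabulary `shadowVocabulary F` with GENUINE global data `ℚ̄ˣ`).  "Embedding into the product" is
typed in its categorical form — **the family `(ρ_v)_v` is JOINTLY MONOMORPHIC** (two morphisms into `M⊚` that agree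
after every `ρ_v` are equal; in a concrete category this is injectivity of `M⊚ → ∏_v M_v`):

* `GlobalTPair.eq_of_forall_comp_restrict_eq` — **REDUCTION, for every vocabulary `W` and every global `T`-pair `P`**: if the
  vocabulary's CANONICAL restriction morphisms `ρ_v(Π) : M_{T⊚}(Π) → M_T(Π, v)^{T⊚}` (`W.locRestrictNon/Arc`, Def 5.1
  (v): "determined by `k_NF(Π)`, … `k^×_NF(Π, v)`, …") at `Π = P.theater.ext` are jointly monomorphic, then so are the
  `ρ_v` of `P` — transported along the reference isomorphisms `ψ⊚`, `ψ_v` by condition (d) of Def 5.1 (v).  Thus the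
  printed "embedding" for ALL global `T`-pairs is exactly the arithmetic fact `k^×_NF ↪ ∏_v k^×_{NF,v}` about the
  canonical data (campaign-L input for print's vocabularies), nothing more;
* `NumberFieldShadow.arc_proVal_nonempty` — the genuine valuation pro-set `V⊚(ℚ̄/ℚ)` of the shadow context has an
  archimedean element (an infinite place of `ℚ̄`, from an embedding `ℚ̄ → ℂ`);
* `NumberFieldShadow.shadowVocabulary_locRestrict_jointlyMono` and
  **`NumberFieldShadow.GlobalTPair.eq_of_forall_comp_restrict_eq_shadow`** — at the number-field shadow vocabulary
  (`ρ_v(Π) := 𝟙`, honest simplification declared there) the hypothesis holds, so EVERY global `TM`-pair over the shadow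
  has jointly monomorphic restriction morphisms, with NO hypothesis.

HONEST LABEL: the shadow instance is near-tautological (identity canonical restrictions + one place); the content is
the reduction.  The remaining steps of Def 5.4 (ii)'s construction (the new embedding `M⊚ ↪ ∏_v log^v(M_v)` and the
resulting `log⊚_{T,T}`) are NOT typed here (every `LogFrobeniusSetting` of the tree takes `log := 𝟭`).  Refereed
pre-IUT anabelian geometry; nothing here bears on [IUTchIII] Cor. 3.12; no side taken; typed ≠ proved; cone node
AbsTopIII:Def5.4(ii) (layer L4), coverage clause C3 of HOME/staging/w6/w6-d033/g6/DEF54ii-PRINT-COVERAGE.md.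
-/

set_option autoImplicit false

noncomputable section

universe u

open CategoryTheory

namespace Literature.AnabelianGeometry.AbsoluteAnabelian

/-! ## The reduction: jointly monomorphic canonical restrictions ⇒ jointly monomorphic `ρ_v` -/

section Reduction

variable {R : GlobalAnabelianContext.{u}} {T : TKind} {W : TPairVocabulary R T}

/-- **[AbsTopIII] Def 5.4 (ii), "the restriction morphisms `ρ_v` determine an embedding `M⊚ ↪ ∏_v M_v`" — reduced
to the canonical data.**  If the vocabulary's canonical restriction morphisms `ρ_v(Π)` at `Π = P.theater.ext` are
jointly monomorphic, then two morphisms `f, g : A → M⊚` with `f ≫ ρ_v = g ≫ ρ_v` for every `v ∈ V̄^non ∪ V̄^arc` are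
equal (transport along the reference isomorphisms `ψ⊚`, `ψ_v` using condition (d) of Def 5.1 (v)).
[cite: MochizukiAbsTopIII2015, Def 5.4 (ii) p. 125] -/
theorem GlobalTPair.eq_of_forall_comp_restrict_eq (P : GlobalTPair W)
    (hW : ∀ ⦃A : W.GlobObj⦄ (f g : A ⟶ W.globData P.theater.ext),
      (∀ v : (R.proVal P.theater.ext).non,
        f ≫ W.locRestrictNon P.theater.ext v = g ≫ W.locRestrictNon P.theater.ext v) →
      (∀ v : (R.proVal P.theater.ext).arc,
        f ≫ W.locRestrictArc P.theater.ext v = g ≫ W.locRestrictArc P.theater.ext v) → f = g)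
    {A : W.GlobObj} (f g : A ⟶ P.M)
    (hnon : ∀ v : P.theater.V.non, f ≫ P.ρnon v = g ≫ P.ρnon v)
    (harc : ∀ v : P.theater.V.arc, f ≫ P.ρarc v = g ≫ P.ρarc v) : f = g := by
  obtain ⟨ψV, -, hn, ha, ψ, ψnon, ψarc, -, -, -, hρnon, hρarc⟩ := P.exists_reference
  have key : f ≫ ψ.inv = g ≫ ψ.inv := by
    refine hW _ _ (fun v => ?_) (fun v => ?_)
    · rw [← cancel_mono (W.toGlob.map (ψnon v).hom)]
      simp only [Category.assoc]
      rw [hρnon v, Iso.inv_hom_id_assoc]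
      exact hnon _
    · rw [← cancel_mono (W.toGlob.map (ψarc v).hom)]
      simp only [Category.assoc]
      rw [hρarc v, Iso.inv_hom_id_assoc]
      exact harc _
  rw [← cancel_mono ψ.inv]
  exact key

/-- Corollary: under the same hypothesis a morphism into `M⊚` is DETERMINED by its composites with the `ρ_v`
(uniqueness form of "embedding into the product of local data"). [cite: MochizukiAbsTopIII2015, Def 5.4 (ii) p. 125] -/
theorem GlobalTPair.existsUnique_of_forall_comp_restrict_eq (P : GlobalTPair W)
    (hW : ∀ ⦃A : W.GlobObj⦄ (f g : A ⟶ W.globData P.theater.ext),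
      (∀ v : (R.proVal P.theater.ext).non,
        f ≫ W.locRestrictNon P.theater.ext v = g ≫ W.locRestrictNon P.theater.ext v) →
      (∀ v : (R.proVal P.theater.ext).arc,
        f ≫ W.locRestrictArc P.theater.ext v = g ≫ W.locRestrictArc P.theater.ext v) → f = g)
    {A : W.GlobObj} (f : A ⟶ P.M) :
    ∃! g : A ⟶ P.M, (∀ v : P.theater.V.non, g ≫ P.ρnon v = f ≫ P.ρnon v) ∧
      (∀ v : P.theater.V.arc, g ≫ P.ρarc v = f ≫ P.ρarc v) :=
  ⟨f, ⟨fun _ => rfl, fun _ => rfl⟩, fun g hg => P.eq_of_forall_comp_restrict_eq hW g f hg.1 hg.2⟩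

end Reduction

/-! ## The instance at the number-field shadow vocabulary -/

namespace NumberFieldShadow

variable (F : Type) [Field F] [NumberField F]

/-- `ℚ̄ = AlgebraicClosure ℚ` has an infinite place (embed it into `ℂ`). [cite: MochizukiAbsTopIII2015, Def 5.1 (i) p. 113] -/
theorem nonempty_infinitePlace_algebraicClosure_rat :
    Nonempty (_root_.NumberField.InfinitePlace (AlgebraicClosure ℚ)) := by
  -- `ℚ̄` is algebraic over `ℚ` for Mathlib's generic `ℚ`-algebra structure (`Algebra ℚ _` is a subsingleton)
  haveI : Algebra.IsAlgebraic ℚ (AlgebraicClosure ℚ) := by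
    convert (AlgebraicClosure.instIsAlgClosure ℚ).isAlgebraic
    · rfl
    · exact Subsingleton.elim _ _
  exact ⟨_root_.NumberField.InfinitePlace.mk (IsAlgClosed.lift (R := ℚ) (M := ℂ) (S := AlgebraicClosure ℚ)).toRingHom⟩

/-- The genuine valuation pro-set `V⊚(Π_E) = V⊚(ℚ̄/ℚ)` of the shadow context has an ARCHIMEDEAN element, for every `E`.
[cite: MochizukiAbsTopIII2015, Def 5.1 (ii) p. 114] -/
theorem arc_proVal_nonempty (E : FundamentalExtension.{0}) : ((context F).proVal E).arc.Nonempty := by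
  obtain ⟨w⟩ := nonempty_infinitePlace_algebraicClosure_rat
  exact ⟨Sum.inr (Sum.inr w), w, rfl⟩

/-- At the shadow vocabulary the CANONICAL restriction morphisms `ρ_v(Π) := 𝟙` are jointly monomorphic (one archimedean
place suffices). [cite: MochizukiAbsTopIII2015, Def 5.4 (ii) p. 125] -/
theorem shadowVocabulary_locRestrict_jointlyMono (E : FundamentalExtension.{0}) ⦃A : (shadowVocabulary F).GlobObj⦄
    (f g : A ⟶ (shadowVocabulary F).globData E)
    (_hnon : ∀ v : ((context F).proVal E).non,
      f ≫ (shadowVocabulary F).locRestrictNon E v = g ≫ (shadowVocabulary F).locRestrictNon E v)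
    (harc : ∀ v : ((context F).proVal E).arc,
      f ≫ (shadowVocabulary F).locRestrictArc E v = g ≫ (shadowVocabulary F).locRestrictArc E v) : f = g := by
  obtain ⟨v, hv⟩ := arc_proVal_nonempty F E
  have h := harc ⟨v, hv⟩
  erw [Category.comp_id, Category.comp_id] at h
  exact h

/-- **[AbsTopIII] Def 5.4 (ii) "embedding into the product of local data" HOLDS for every global `TM`-pair over the
number-field shadow vocabulary, with no hypothesis**: the restriction morphisms `ρ_v` of any `P : GlobalTPair
(shadowVocabulary F)` are jointly monomorphic. [cite: MochizukiAbsTopIII2015, Def 5.4 (ii) p. 125] -/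
theorem GlobalTPair.eq_of_forall_comp_restrict_eq_shadow (P : GlobalTPair (shadowVocabulary F))
    {A : (shadowVocabulary F).GlobObj} (f g : A ⟶ P.M)
    (hnon : ∀ v : P.theater.V.non, f ≫ P.ρnon v = g ≫ P.ρnon v)
    (harc : ∀ v : P.theater.V.arc, f ≫ P.ρarc v = g ≫ P.ρarc v) : f = g :=
  P.eq_of_forall_comp_restrict_eq (fun _ f' g' h₁ h₂ => shadowVocabulary_locRestrict_jointlyMono F P.theater.ext f' g' h₁ h₂)
    f g hnon harc

/-- In particular for abc-iut-L4-d2's canonical global `TM`-pair `M⊚_TM(E_F)` over the shadow.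
[cite: MochizukiAbsTopIII2015, Def 5.4 (ii) p. 125] -/
theorem shadowGlobalTPair_eq_of_forall_comp_restrict_eq {A : (shadowVocabulary F).GlobObj}
    (f g : A ⟶ (shadowGlobalTPair F).M)
    (hnon : ∀ v : (shadowGlobalTPair F).theater.V.non, f ≫ (shadowGlobalTPair F).ρnon v = g ≫ (shadowGlobalTPair F).ρnon v)
    (harc : ∀ v : (shadowGlobalTPair F).theater.V.arc, f ≫ (shadowGlobalTPair F).ρarc v = g ≫ (shadowGlobalTPair F).ρarc v) :
    f = g :=
  GlobalTPair.eq_of_forall_comp_restrict_eq_shadow F (shadowGlobalTPair F) f g hnon harc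

end NumberFieldShadow

end Literature.AnabelianGeometry.AbsoluteAnabelian

end
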